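import Mathlib
import Literature.MathematicalPhysics.KineticTheory.HardSphereEuler
import HarnessLib

/-!
# `EntropicWeakStrongHS` (stmt-AtomisticToContinuum-13461), algebra II: absorption, the
# relative entropy in primitive variables, and elementary convexity bounds

Real-variable lemmas for the pointwise estimates of Dafermos' relative-entropy argument for the
hard-sphere Euler system:

* `absorb_quadratic` — a grouped quadratic form `Σ δᵢδⱼ qᵢⱼ + R q_R` with bounded coefficients
  and `|R| ≤ C_R a²` is bounded by `B(3 + C_R)(a² + |b|² + c²)`;
* `theta_mul_hrel_eq` — the relative entropy density `h(V) - h(U) - Dh(U)·(V - U)` of the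
  hard-sphere entropy `h = -ρ(3/2 log θ - log ρ - f)` in primitive variables:
  `θ·H = ½ r|w-u|² + 3/2 rθ φ(ϑ/θ) + θρ·klFun(r/ρ) + θ·Breg_g(r|ρ)`, `φ(z) = z - 1 - log z`;
* `klFun_ge_sq`, `sub_one_sub_log_ge_sq` — quadratic lower bounds for `klFun` and `φ` on `(0, M]`;
* `exists_taylor_two_bound` — `|ζ(y) - ζ(x) - ζ'(x)(y-x)| ≤ C (y-x)²` on a compact interval for
  `ζ` of class `C²` on an open set.
-/

noncomputable section

open Set InformationTheory

namespace Summit.AtomisticToContinuum.HydrodynamicLimit.Theorems.EntropicWeakStrong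

open Literature.MathematicalPhysics.KineticTheory (V3)

/-! ### Absorption of a grouped quadratic form -/

/-- `|x y q| ≤ B (x² + y²)/2` when `|q| ≤ B`. -/
theorem abs_mul_mul_le_of_abs_le {x y q B : ℝ} (hq : |q| ≤ B) :
    |x * y * q| ≤ B * ((x ^ 2 + y ^ 2) / 2) := by
  rw [abs_mul, abs_mul]
  have hB : 0 ≤ B := (abs_nonneg _).trans hq
  have hxy : |x| * |y| ≤ (x ^ 2 + y ^ 2) / 2 := by
    nlinarith [sq_nonneg (|x| - |y|), sq_abs x, sq_abs y]
  calc |x| * |y| * |q| = |q| * (|x| * |y|) := by ring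
    _ ≤ B * ((x ^ 2 + y ^ 2) / 2) :=
      mul_le_mul hq hxy (mul_nonneg (abs_nonneg _) (abs_nonneg _)) hB

/-- **Absorption of the grouped relative flux.** A quadratic form in the small quantities
`a, b0, b1, b2, c` grouped by monomials, with coefficients bounded by `B`, plus a remainder term
`R q` with `|R| ≤ C_R a²`, is at most `B (3 + C_R) (a² + b0² + b1² + b2² + c²)`. -/
theorem absorb_quadratic {a b0 b1 b2 c R B CR q1 q2 q3 q4 q5 q6 q7 q8 q9 q10 q11 q12 q13 q14 q15 : ℝ}
    (hB : 0 ≤ B) (hCR : 0 ≤ CR)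
    (h1 : |q1| ≤ B) (h2 : |q2| ≤ B) (h3 : |q3| ≤ B) (h4 : |q4| ≤ B) (h5 : |q5| ≤ B)
    (h6 : |q6| ≤ B) (h7 : |q7| ≤ B) (h8 : |q8| ≤ B) (h9 : |q9| ≤ B) (h10 : |q10| ≤ B)
    (h11 : |q11| ≤ B) (h12 : |q12| ≤ B) (h13 : |q13| ≤ B) (h14 : |q14| ≤ B) (h15 : |q15| ≤ B)
    (hR : |R| ≤ CR * a ^ 2) :
    |a * a * q1 + a * b0 * q2 + a * b1 * q3 + a * b2 * q4 + a * c * q5 + b0 * b0 * q6 +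
        b0 * b1 * q7 + b0 * b2 * q8 + b0 * c * q9 + b1 * b1 * q10 + b1 * b2 * q11 + b1 * c * q12 +
        b2 * b2 * q13 + b2 * c * q14 + R * q15| ≤
      B * (3 + CR) * (a ^ 2 + b0 ^ 2 + b1 ^ 2 + b2 ^ 2 + c ^ 2) := by
  have e1 := abs_mul_mul_le_of_abs_le (x := a) (y := a) h1
  have e2 := abs_mul_mul_le_of_abs_le (x := a) (y := b0) h2
  have e3 := abs_mul_mul_le_of_abs_le (x := a) (y := b1) h3
  have e4 := abs_mul_mul_le_of_abs_le (x := a) (y := b2) h4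
  have e5 := abs_mul_mul_le_of_abs_le (x := a) (y := c) h5
  have e6 := abs_mul_mul_le_of_abs_le (x := b0) (y := b0) h6
  have e7 := abs_mul_mul_le_of_abs_le (x := b0) (y := b1) h7
  have e8 := abs_mul_mul_le_of_abs_le (x := b0) (y := b2) h8
  have e9 := abs_mul_mul_le_of_abs_le (x := b0) (y := c) h9
  have e10 := abs_mul_mul_le_of_abs_le (x := b1) (y := b1) h10
  have e11 := abs_mul_mul_le_of_abs_le (x := b1) (y := b2) h11
  have e12 := abs_mul_mul_le_of_abs_le (x := b1) (y := c) h12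
  have e13 := abs_mul_mul_le_of_abs_le (x := b2) (y := b2) h13
  have e14 := abs_mul_mul_le_of_abs_le (x := b2) (y := c) h14
  have e15 : |R * q15| ≤ B * (CR * a ^ 2) := by
    rw [abs_mul]
    calc |R| * |q15| ≤ CR * a ^ 2 * B :=
          mul_le_mul hR h15 (abs_nonneg _) (mul_nonneg hCR (sq_nonneg _))
      _ = B * (CR * a ^ 2) := by ring
  rw [abs_le] at e1 e2 e3 e4 e5 e6 e7 e8 e9 e10 e11 e12 e13 e14 e15 ⊢
  have hexp : B * (3 + CR) * (a ^ 2 + b0 ^ 2 + b1 ^ 2 + b2 ^ 2 + c ^ 2) =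
      3 * (B * a ^ 2) + 3 * (B * b0 ^ 2) + 3 * (B * b1 ^ 2) + 3 * (B * b2 ^ 2) + 3 * (B * c ^ 2) +
        B * (CR * a ^ 2) + B * CR * (b0 ^ 2 + b1 ^ 2 + b2 ^ 2 + c ^ 2) := by ring
  have hj : 0 ≤ B * CR * (b0 ^ 2 + b1 ^ 2 + b2 ^ 2 + c ^ 2) := by positivity
  have hc2 : 0 ≤ B * c ^ 2 := by positivity
  rw [hexp]
  constructor
  · linarith [e1.1, e2.1, e3.1, e4.1, e5.1, e6.1, e7.1, e8.1, e9.1, e10.1, e11.1, e12.1, e13.1,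
      e14.1, e15.1]
  · linarith [e1.2, e2.2, e3.2, e4.2, e5.2, e6.2, e7.2, e8.2, e9.2, e10.2, e11.2, e12.2, e13.2,
      e14.2, e15.2]

/-! ### The relative entropy density in primitive variables -/

/-- **The hard-sphere relative entropy in primitive variables.** For `U = (ρ, ρu, ρ(|u|²/2+3θ/2))`,
`V = (r, rw, r(|w|²/2+3ϑ/2))`, entropy `h(ρ,θ) = -ρ(3/2 log θ - log ρ - f)` (`fU = f(ρσ³)`,
`fV = f(rσ³)`, `gU = ρσ³f'(ρσ³)`) and entropy variables
`λ = (-(3/2 log θ - log ρ - fU) + 5/2 - |u|²/(2θ) + gU, u/θ, -1/θ)`: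
`h(V) - h(U) - λ·(V - U) = θ⁻¹ (½ r|w-u|² + 3/2 rθ ((ϑ/θ - 1) - log(ϑ/θ)) + θρ·klFun(r/ρ)
  + θ (r fV - ρ fU - (fU + gU)(r - ρ)))`. -/
theorem hrel_primitive_form {ρ θ r ϑ EV EU : ℝ} {u w : V3} (hθ : 0 < θ) (hρ : 0 < ρ) (hr : 0 < r)
    (hϑ : 0 < ϑ) (hEV : EV = r * (‖w‖ ^ 2 / 2 + 3 / 2 * ϑ)) (hEU : EU = ρ * (‖u‖ ^ 2 / 2 + 3 / 2 * θ))
    (fV fU gU : ℝ) :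
    -(r * (3 / 2 * Real.log ϑ - Real.log r - fV)) - -(ρ * (3 / 2 * Real.log θ - Real.log ρ - fU)) -
      ((-(3 / 2 * Real.log θ - Real.log ρ - fU) + 5 / 2 - ‖u‖ ^ 2 / (2 * θ) + gU) * (r - ρ) +
        (∑ j, (θ⁻¹ • u) j * (r • w - ρ • u) j) + (-θ⁻¹) * (EV - EU)) =
      θ⁻¹ * (1 / 2 * r * ‖w - u‖ ^ 2 + 3 / 2 * r * θ * ((ϑ / θ - 1) - Real.log (ϑ / θ)) +
        θ * ρ * klFun (r / ρ) + θ * (r * fV - ρ * fU - (fU + gU) * (r - ρ))) := by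
  have hlog1 : Real.log (ϑ / θ) = Real.log ϑ - Real.log θ := Real.log_div hϑ.ne' hθ.ne'
  have hlog2 : Real.log (r / ρ) = Real.log r - Real.log ρ := Real.log_div hr.ne' hρ.ne'
  rw [klFun_apply, hlog1, hlog2, hEV, hEU]
  simp only [EuclideanSpace.norm_sq_eq, Real.norm_eq_abs, sq_abs, Fin.sum_univ_three,
    PiLp.smul_apply, PiLp.sub_apply, smul_eq_mul]
  field_simp
  ring

/-! ### Elementary quadratic lower bounds -/

/-- `klFun z = z log z + 1 - z ≥ (z-1)²/(2M)` for `0 < z ≤ M`, `1 ≤ M`. -/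
theorem klFun_ge_sq {z M : ℝ} (hz : 0 < z) (hzM : z ≤ M) (hM : 1 ≤ M) :
    (z - 1) ^ 2 / (2 * M) ≤ klFun z := by
  have hM0 : 0 < M := by linarith
  set ψ : ℝ → ℝ := fun y => klFun y - (y - 1) ^ 2 / (2 * M) with hψ
  have hderiv : ∀ y, 0 < y → HasDerivAt ψ (Real.log y - (y - 1) / M) y := by
    intro y hy
    have h1 := hasDerivAt_klFun hy.ne'
    have h2 : HasDerivAt (fun y : ℝ => (y - 1) ^ 2 / (2 * M)) ((y - 1) / M) y := by
      have h := (((hasDerivAt_id y).sub_const 1).mul ((hasDerivAt_id y).sub_const 1)).div_const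
        (2 * M)
      simp only [id, ← sq] at h
      exact h.congr_deriv (by ring)
    exact h1.sub h2
  have hcont : ∀ y, 0 < y → ContinuousAt ψ y := fun y hy => (hderiv y hy).continuousAt
  have hψ1 : ψ 1 = 0 := by simp [hψ, klFun_one]
  suffices h : 0 ≤ ψ z by simp only [hψ] at h; linarith
  rcases le_or_gt 1 z with h1z | hz1
  · -- monotone on `[1, M]`
    have hmono : MonotoneOn ψ (Icc 1 M) := by
      refine monotoneOn_of_deriv_nonneg (convex_Icc 1 M)
        (fun y hy => (hcont y (by linarith [hy.1])).continuousWithinAt)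
        (fun y hy => ?_) (fun y hy => ?_)
      · rw [interior_Icc] at hy
        exact (hderiv y (by linarith [hy.1])).differentiableAt.differentiableWithinAt
      · rw [interior_Icc] at hy
        have hy0 : 0 < y := by linarith [hy.1]
        rw [(hderiv y hy0).deriv]
        have hl : 1 - y⁻¹ ≤ Real.log y := Real.one_sub_inv_le_log_of_pos hy0
        have h2 : (y - 1) / M ≤ (y - 1) / y :=
          div_le_div_of_nonneg_left (by linarith [hy.1]) hy0 hy.2.le
        have h3 : (y - 1) / y = 1 - y⁻¹ := by field_simp
        linarith
    rw [← hψ1]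
    exact hmono ⟨le_rfl, by linarith⟩ ⟨h1z, hzM⟩ h1z
  · -- antitone on `(0, 1]`
    have hanti : AntitoneOn ψ (Ioc 0 1) := by
      refine antitoneOn_of_deriv_nonpos (convex_Ioc 0 1)
        (fun y hy => (hcont y hy.1).continuousWithinAt) (fun y hy => ?_) (fun y hy => ?_)
      · rw [interior_Ioc] at hy
        exact (hderiv y hy.1).differentiableAt.differentiableWithinAt
      · rw [interior_Ioc] at hy
        rw [(hderiv y hy.1).deriv]
        have hl : Real.log y ≤ y - 1 := Real.log_le_sub_one_of_pos hy.1
        have h2 : y - 1 ≤ (y - 1) / M := by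
          rw [le_div_iff₀ hM0]
          nlinarith [hy.2]
        linarith
    rw [← hψ1]
    exact hanti ⟨hz, hz1.le⟩ ⟨one_pos, le_rfl⟩ hz1.le

/-- `z - 1 - log z ≥ (z-1)²/(2M²)` for `0 < z ≤ M`, `1 ≤ M`. -/
theorem sub_one_sub_log_ge_sq {z M : ℝ} (hz : 0 < z) (hzM : z ≤ M) (hM : 1 ≤ M) :
    (z - 1) ^ 2 / (2 * M ^ 2) ≤ z - 1 - Real.log z := by
  have hM0 : 0 < M := by linarith
  have hM2 : 0 < M ^ 2 := by positivity
  set ψ : ℝ → ℝ := fun y => y - 1 - Real.log y - (y - 1) ^ 2 / (2 * M ^ 2) with hψ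
  have hderiv : ∀ y, 0 < y → HasDerivAt ψ (1 - y⁻¹ - (y - 1) / M ^ 2) y := by
    intro y hy
    have h1 : HasDerivAt (fun y : ℝ => y - 1 - Real.log y) (1 - y⁻¹) y :=
      ((hasDerivAt_id y).sub_const 1).sub (Real.hasDerivAt_log hy.ne')
    have h2 : HasDerivAt (fun y : ℝ => (y - 1) ^ 2 / (2 * M ^ 2)) ((y - 1) / M ^ 2) y := by
      have h := (((hasDerivAt_id y).sub_const 1).mul ((hasDerivAt_id y).sub_const 1)).div_const
        (2 * M ^ 2)
      simp only [id, ← sq] at h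
      exact h.congr_deriv (by ring)
    exact h1.sub h2
  have hcont : ∀ y, 0 < y → ContinuousAt ψ y := fun y hy => (hderiv y hy).continuousAt
  have hψ1 : ψ 1 = 0 := by simp [hψ]
  suffices h : 0 ≤ ψ z by simp only [hψ] at h; linarith
  rcases le_or_gt 1 z with h1z | hz1
  · have hmono : MonotoneOn ψ (Icc 1 M) := by
      refine monotoneOn_of_deriv_nonneg (convex_Icc 1 M)
        (fun y hy => (hcont y (by linarith [hy.1])).continuousWithinAt)
        (fun y hy => ?_) (fun y hy => ?_)
      · rw [interior_Icc] at hy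
        exact (hderiv y (by linarith [hy.1])).differentiableAt.differentiableWithinAt
      · rw [interior_Icc] at hy
        have hy0 : 0 < y := by linarith [hy.1]
        rw [(hderiv y hy0).deriv]
        have h2 : (y - 1) / M ^ 2 ≤ (y - 1) / y := by
          refine div_le_div_of_nonneg_left (by linarith [hy.1]) hy0 ?_
          nlinarith [hy.2]
        have h3 : (y - 1) / y = 1 - y⁻¹ := by field_simp
        linarith
    rw [← hψ1]
    exact hmono ⟨le_rfl, by linarith⟩ ⟨h1z, hzM⟩ h1z
  · have hanti : AntitoneOn ψ (Ioc 0 1) := by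
      refine antitoneOn_of_deriv_nonpos (convex_Ioc 0 1)
        (fun y hy => (hcont y hy.1).continuousWithinAt) (fun y hy => ?_) (fun y hy => ?_)
      · rw [interior_Ioc] at hy
        exact (hderiv y hy.1).differentiableAt.differentiableWithinAt
      · rw [interior_Ioc] at hy
        rw [(hderiv y hy.1).deriv]
        have hy0 : y ≠ 0 := hy.1.ne'
        have hfac : 1 - y⁻¹ - (y - 1) / M ^ 2 = (y - 1) * (y⁻¹ - (M ^ 2)⁻¹) := by
          field_simp
        rw [hfac]
        refine mul_nonpos_of_nonpos_of_nonneg (by linarith [hy.2]) (sub_nonneg.2 ?_)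
        exact inv_anti₀ hy.1 (by nlinarith [hy.2])
    rw [← hψ1]
    exact hanti ⟨hz, hz1.le⟩ ⟨one_pos, le_rfl⟩ hz1.le

/-! ### Second-order Taylor bound -/

/-- **Second-order Taylor bound on a compact interval.** For `ζ` of class `C²` on an open set
`J ⊇ [a, b]` there is `C ≥ 0` with `|ζ y - ζ x - ζ'(x)(y - x)| ≤ C (y - x)²` for all
`x, y ∈ [a, b]` (mean value inequality applied to `y ↦ ζ y - ζ'(x) y`, whose derivative
`ζ' y - ζ' x` is bounded by `C |y - x|`, `C` a bound of `ζ''` on `[a, b]`). -/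
theorem exists_taylor_two_bound {ζ : ℝ → ℝ} {J : Set ℝ} (hJ : IsOpen J) (hζ : ContDiffOn ℝ 2 ζ J)
    {a b : ℝ} (hab : Icc a b ⊆ J) :
    ∃ C, 0 ≤ C ∧ ∀ x ∈ Icc a b, ∀ y ∈ Icc a b,
      |ζ y - ζ x - deriv ζ x * (y - x)| ≤ C * (y - x) ^ 2 := by
  have hζ' : ContDiffOn ℝ 1 (deriv ζ) J := hζ.deriv_of_isOpen hJ (by norm_num)
  have hcont'' : ContinuousOn (deriv (deriv ζ)) (Icc a b) :=
    ((hζ'.deriv_of_isOpen (m := 0) hJ (by norm_num)).continuousOn).mono hab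
  obtain ⟨L, hL⟩ := isCompact_Icc.exists_bound_of_continuousOn hcont''
  set C := max L 0 with hC
  refine ⟨C, le_max_right _ _, fun x hx y hy => ?_⟩
  -- `ζ'` is `C`-Lipschitz on `[a, b]`
  have hd2 : ∀ s ∈ Icc a b, HasDerivWithinAt (deriv ζ) (deriv (deriv ζ) s) (Icc a b) s := fun s hs =>
    (((hζ'.differentiableOn one_ne_zero).differentiableAt (hJ.mem_nhds (hab hs))).hasDerivAt).hasDerivWithinAt
  have hlip : ∀ s ∈ Icc a b, ∀ s' ∈ Icc a b, |deriv ζ s - deriv ζ s'| ≤ C * |s - s'| := by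
    intro s hs s' hs'
    have h := (convex_Icc a b).norm_image_sub_le_of_norm_hasDerivWithin_le hd2
      (fun r hr => (hL r hr).trans (le_max_left L 0)) hs' hs
    simpa only [Real.norm_eq_abs] using h
  -- mean value inequality for `R(y) = ζ y - ζ x - ζ'(x)(y - x)` on the segment
  have hseg : uIcc x y ⊆ Icc a b := uIcc_subset_Icc hx hy
  have hd1 : ∀ s ∈ uIcc x y, HasDerivWithinAt (fun s => ζ s - ζ x - deriv ζ x * (s - x))
      (deriv ζ s - deriv ζ x) (uIcc x y) s := by
    intro s hs
    have h1 : HasDerivAt ζ (deriv ζ s) s :=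
      ((hζ.differentiableOn (by norm_num)).differentiableAt (hJ.mem_nhds (hab (hseg hs)))).hasDerivAt
    have h2 : HasDerivAt (fun s => ζ s - ζ x - deriv ζ x * (s - x)) (deriv ζ s - deriv ζ x * 1) s :=
      (h1.sub_const _).sub (((hasDerivAt_id s).sub_const x).const_mul _)
    rw [mul_one] at h2
    exact h2.hasDerivWithinAt
  have hbd : ∀ s ∈ uIcc x y, ‖deriv ζ s - deriv ζ x‖ ≤ C * |y - x| := by
    intro s hs
    rw [Real.norm_eq_abs]
    refine (hlip s (hseg hs) x hx).trans (mul_le_mul_of_nonneg_left ?_ (le_max_right _ _))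
    exact abs_sub_le_of_uIcc_subset_uIcc (uIcc_subset_uIcc_left hs)
  have h := (convex_uIcc x y).norm_image_sub_le_of_norm_hasDerivWithin_le hd1 hbd
    left_mem_uIcc right_mem_uIcc
  simp only [sub_self, mul_zero, sub_zero, Real.norm_eq_abs] at h
  calc |ζ y - ζ x - deriv ζ x * (y - x)| ≤ C * |y - x| * |y - x| := h
    _ = C * (y - x) ^ 2 := by rw [mul_assoc, ← sq, sq_abs]

end Summit.AtomisticToContinuum.HydrodynamicLimit.Theorems.EntropicWeakStrong

end
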